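import Summits.QuantumFields.YangMills.Theorems.BalabanUVNodesN07SplitClauseRecordShearAtCubeDomains
import Summits.QuantumFields.YangMills.Theorems.BalabanUVNodesN07LocalLettersHBAtCubeDomains
import Summits.QuantumFields.YangMills.Theorems.BalabanUVNodesK0S5CollarNumerics
import HarnessLib

/-!
# N07 [B11] (= [15] = [Balaban1985Variational]) Sect. F, road of record R0′, S6 HEAD: **THE (159)-ASSEMBLY AT THE HEAD's FAMILY AND WINDOW** — the (r2) record door
# (FILE 2) with the two `H`-letters of (159) SUPPLIED by the S6 doors at the same family ∕ window: `A₂ = H_V B` (the `HB` summand, data in print's shapes (160) centred ∕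
# (155) uniform — dag-n07-w4 g2 `letters10On_HB_cubeDomains_box`) and `A₃ = H_V B′` (a uniformly `s`-small datum: the chart defect `𝔇(A′)` and the BCH remainder);
# what stays displayed is the other lanes' content: S3's gauge, the (159) identity's objects, `A₁`'s letters, the data sizes, the Landau copy's rows

Cell `pub-ymgap`, width seat `pub-ymgap-dag-n07-w4` g4 (sub-target S6 = the HEAD), CLAIM-3 ∕ INTENT-3 (cell bus).  `--kind proof --supports stmt-QuantumFields-27364 --as helper`
(K1⁹ per dag-lead KEY MAP v2); count-neutral; def-free.  [15] = [Balaban1985Variational]; [6] = [Balaban1985RegularSpaces]; [4] = [Balaban1984PropagatorsII]; [I.4] =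
[Balaban1984PropagatorsI]; [3] = [Balaban1985Averaging].

THE POINT.  STEP 7 of the head's recipe (`S6-HEAD-RECIPE.md`): per datum, the (159)-splitting `A − G = A₁ + H_V B″ − (H_V𝔇(A′) − H_V N₂)` of S3's potential `A` (shift `G`
split off, road R0′) is fed letter by letter into the split clause.  In the tree, at the head's per-datum family `cubeDomains (F.P K) a M ρ (K − n)` and window `π '' □`:
the shift side is FILE 2 `localGaugeSplitOn_of_gauge152_recordShear_dominated_cubeDomains_box` (n07-w8's sign-free record door, geometry ∕ admissibility discharged), the
`H_V B` letter is `N07LocalLettersHBAtCubeDomains.letters10On_HB_cubeDomains_box` (data (160) centred at a window point `x_c`, (155) uniform below — via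
`N07NearDataOfCentre.near_of_centred_box`), the `H_V B′` letter for a uniformly small datum is the same door at `C_d = M_Δ = 1`.  THIS FILE composes the three BY NAME with
SHARED `H`-constants (one call of the `HB` door, two instances): there are `M_h⁰, R₀`, shear constants `C_S ≥ 0`, `B_S > 0` and `H`-constants `C_H ≥ 0`, `δ_H, B_H > 0` such
that, under the HB door's side conditions (+ `L ≤ ρ`, `1 ≤ M`), for every extension `H_V` (kernel formula), data `B` with `‖B c‖ ≤ β₁·(dist_k(c₋, Bᵏ(π x_c)) + 1)` on the top
cells and `‖B c‖ ≤ β₂` below, datum `B′` with `‖B′ c‖ ≤ s`, `8C_HB_He^{−δ_Hρ} ≤ θ`, Landau copy `u♮, U₁` with per-level letters `v_j, a_j` on the canonical boxes and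
`d(M + 4ρ + 3)L^{(K−n)−j}(v_j + a_j) ≤ σ ≤ ½`, any family `λ` dominated by `log ĝ_j⁻¹` with coarse gradient `X`, S3's gauge `u` of `U` on `π '' □` with (152) letters `t`,
any `A₁` with `Letters10On (π '' □) η t₁ A₁`, and the identity `A − H_V X = A₁ + H_V B − H_V B′`:
`LocalGaugeSplitOn (π '' □) η_{K−n} t (t₁ + (t₂ + t_∂) + t₃) U` for every `t₂ > ¼M·max{4C_HB_Hβ₁, θβ₂∕M}`, `t₃ > ¼max{4C_HB_Hs, θs}`, `t_∂ > 2C_SB_S·(4σ)`.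

WHAT IS PROVED (sorry-free; no definition; axioms standard).  ★★★ `localGaugeSplitOn_head159_cubeDomains_box F N` (statement above); ★★★ `localGaugeSplitOn_head159_printCube_box F N`
(the same AT THE PRINT DATUM `a := cornerP Mc ρ idx`, `M := sideP Mc ρ` of a grid cube — the keying of the head's per-datum tokens — with the five numerics ∕ non-wrapping binders and
`1 ≤ M` discharged by k0-s1-w3's `K0S5CollarNumerics.numerics_propCubeP` ∕ 36a `le_sideP` from `F.L·M_h ∣ ρ` and the torus-size floor `Mc + 11d + 6ρ ≤ sitesPerDir (K − n)`).
HONEST SCOPE.  Count-neutral by-name composition of landed theorems (FILE 2, dag-n07-w4 g2 p608218, n07-w8 p627069); nothing of [15]∕[6]∕[4]∕[3] ANALYSIS asserted; DISPLAYED,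
not discharged: `H_V`'s kernel formula, the data sizes (160)∕(155) (BRIDGE-92), the uniform size `s` of `B′` ((157) ∕ P3a), `A₁` and its letters (k0-s1-w1), S3's gauge and
(152) letters (n07-w3 ∕ N05's Prop 6), the (159) identity and its objects (the chart lane: k0-s1-w2, n07-w2, n07-w7), the Landau copy's rows `v_j, a_j` (n07-w6) and its
identification with S3's gauge, the thresholds; `LocalLettersSplitTopStepCore(G∕R)` ∕ `DatumGaugeSplitTopStepCore(G∕R)` ∕ `HalvingStepTop(Core)` ∕ `stub_prop8StepCoP13` NOT
discharged; K0⁷ ∕ K1⁹ NOT closed; N07 NOT discharged; counts unmoved (typed 28∕28 · discharged 5∕27); one finite 𝕋⁴ programme at fixed ε — the route closes the conditional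
finite-𝕋⁴ rung `BalabanLadder.UV` ONLY; the YM mass gap (Clay) is NOT proved by any of this; nothing continuum ∕ ℝ⁴ ∕ OS.  No `sorry`, no `def`, no `instance`, no `notation`.

RELATED IN THE TREE, NOT DUPLICATED: FILE 2 `N07SplitClauseRecordShearAtCubeDomains` (shift side — CONSUMED); k0-s1-w3 `K0S5CollarNumerics` (print-datum numerics — CONSUMED); `N07LocalLettersHBAtCubeDomains` (the `H` doors — CONSUMED, the
centred ∕ uniform instances replayed inline so that both letters share ONE set of `H`-constants); `N07NearDataOfCentre.near_of_centred_box` (CONSUMED); g0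
`N07HalvingStepTopOfLocalLetters.localGauge10On_of_eq159` (the R4-edition assembly with three abstract letters — the ancestor; here R0′ and at the record's family).

References: [15] (144) p. 300, (150)–(152) p. 301, (155) p. 302, (157)–(159) pp. 302–303, (160)–(161) p. 303, (163)–(165) p. 304, (168) p. 304; [6] (1.131) pp. 98–99;
[4] (2.1)–(2.4) p. 224, (2.60) p. 234, Cor. 2.8 (2.150)–(2.151) p. 249; [I.4] (1.18)–(1.20) p. 20; [3] (85)–(88) p. 31.
-/

set_option autoImplicit false

noncomputable section
open scoped BigOperators Matrix.Norms.L2Operator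

namespace Summit.QuantumFields.YangMills.BalabanUVNodes.N07SplitClauseHeadAtCubeDomains

open Literature.MathematicalPhysics.QuantumFieldTheory.Balaban1983to89
open Literature.MathematicalPhysics.QuantumFieldTheory.Balaban1983to89.Node00
open Literature.MathematicalPhysics.QuantumFieldTheory.Balaban1983to89.B12RegularSpaces111 (gaugeU expI grad)
open B15Eq112TorusCover (cover)
open B14DomainGeom (Pt)
open B5Eq117TorusCarriers (Mk)
open B5Eq118OneStroke (iterBlockOf)
open B5Prop12FieldsLattice (distSite)
open B8Eq131Cubes (sqLo sqHi box cube)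
open B11Eq115Space (levOf)
open B6SectADomainsV1 (Domains)
open B6SectAOperatorsV1 (BondIdx)
open T4Continuum (T4Family)
open T4AxialGaugeSmallField (castSite)
open B16Sect1Backgrounds (toMS)
open GaugeField (gaugeAct)
open MatrixLog (mlog)
open Summit.QuantumFields.YangMills.Theorems.FlatCubeOpsText (Adm22 distBI)
open Summit.QuantumFields.YangMills.Theorems.K0FlatCubeOpsTextP (flatH IsLevWeight)
open Summit.QuantumFields.YangMills.BalabanUVNodes.N07HalvingStepTopOfLocalLetters (Letters10On)
open Summit.QuantumFields.YangMills.BalabanUVNodes.N07LocalLettersSplitCore (LocalGaugeSplitOn)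
open Summit.QuantumFields.YangMills.BalabanUVNodes.N07SplitClauseRecordShearAtCubeDomains (localGaugeSplitOn_of_gauge152_recordShear_dominated_cubeDomains_box)
open Summit.QuantumFields.YangMills.BalabanUVNodes.N07LocalLettersHBAtCubeDomains (letters10On_HB_cubeDomains_box)
open Summit.QuantumFields.YangMills.BalabanUVNodes.N07NearDataOfCentre (near_of_centred_box)
open Summit.QuantumFields.YangMills.Theorems.K0S5CollarNumerics (numerics_propCubeP)

open scoped Classical in
/-- ★★★ **THE (159)-ASSEMBLY AT THE HEAD's FAMILY AND WINDOW** (statement in the header): FILE 2's sign-free (r2) record door with `A₂ := H_V B` (data (160) centred ∕ (155)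
uniform) and `A₃ := H_V B′` (`‖B′ c‖ ≤ s`) supplied by the `HB` door at the same family ∕ window, `H`-constants shared; displayed: `H_V`'s kernel formula, the data sizes,
`s`, `A₁`'s letters, S3's gauge and (152) letters, the identity `A − H_V X = A₁ + H_V B − H_V B′`, the Landau copy's rows, the thresholds.
[cite: Balaban1985Variational, (144) p.300, (150)–(152) p.301, (155) p.302, (157)–(159) pp.302–303, (160)–(161) p.303, (163)–(165) p.304, (168) p.304; Balaban1985RegularSpaces, (1.131) pp.98–99; Balaban1984PropagatorsII, (2.1)–(2.4) p.224, (2.60) p.234, Cor. 2.8 (2.150)–(2.151) p.249; Balaban1984PropagatorsI, (1.18)–(1.20) p.20; Balaban1985Averaging, (85)–(88) p.31] -/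
theorem localGaugeSplitOn_head159_cubeDomains_box (F : T4Family) (N : ℕ) [NeZero N] :
    ∃ (Mh₀ R₀ : ℕ) (CS BS CH δH BH : ℝ), 0 ≤ CS ∧ 0 < BS ∧ 0 ≤ CH ∧ 0 < δH ∧ 0 < BH ∧
    ∀ (n K : ℕ) (_ : 1 ≤ K - n) (_ : K - n + 1 ≤ F.m + K) (hk : K - n ≤ (F.P K).m + (F.P K).K)
      {Mh R a' : ℕ} (_ : Mh = F.L ^ a') (_ : Mh₀ ≤ Mh) (_ : R₀ ≤ R) (_ : a' + 3 ≤ F.m + n)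
      {a : Pt (F.P K).d} {M ρ : ℕ} (_ : 1 ≤ M)
      (_ : F.L * Mh ∣ ρ) (_ : ∀ i, ((F.L * Mh : ℕ) : ℤ) ∣ a i) (_ : F.L * Mh ∣ M) (_ : F.L * Mh ∣ (F.P K).sitesPerDir (K - n)) (_ : R * (F.L * Mh) ≤ ρ)
      (_ : F.L ≤ ρ) (_ : Set.InjOn (cover (F.P K)) (cube (F.P K).L a M ρ (K - n) 0))
      {HV : (BondIdx (cubeDomains (F.P K) a M ρ (K - n) hk) → MatA N) →ₗ[ℂ] (PBond (F.P K) 0 → MatA N)}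
      (_ : ∀ (B : BondIdx (cubeDomains (F.P K) a M ρ (K - n) hk) → MatA N) (b : PBond (F.P K) 0),
        HV B b = ∑ c, ((flatH (F.P K) (K - n) (cubeDomains (F.P K) a M ρ (K - n) hk) (Pi.single c 1) b : ℝ) : ℂ) • B c)
      -- the `HB` summand's datum in print's shapes: (160) centred at a window point, (155) uniform below; the (163)-type smallness of `θ`
      {xc : Pt (F.P K).d} (_ : xc ∈ box (F.P K).L a M (K - n))
      {β₁ β₂ θ : ℝ} (_ : 0 ≤ β₁) (_ : 0 ≤ β₂) (_ : 8 * CH * BH * Real.exp (-(δH * (ρ : ℝ))) ≤ θ)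
      {B : BondIdx (cubeDomains (F.P K) a M ρ (K - n) hk) → MatA N}
      (_ : ∀ c : BondIdx (cubeDomains (F.P K) a M ρ (K - n) hk), (c.1.1 : ℕ) = K - n →
        ‖B c‖ ≤ β₁ * (distSite (Mk (F.P K) (c.1.1 : ℕ)) c.1.2.src (iterBlockOf (c.1.1 : ℕ) (cover (F.P K) xc)) + 1))
      (_ : ∀ c : BondIdx (cubeDomains (F.P K) a M ρ (K - n) hk), (c.1.1 : ℕ) < K - n → ‖B c‖ ≤ β₂)
      -- the third summand's datum, uniformly small
      {B' : BondIdx (cubeDomains (F.P K) a M ρ (K - n) hk) → MatA N} {s : ℝ} (_ : 0 ≤ s) (_ : ∀ c, ‖B' c‖ ≤ s)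
      -- the CANONICAL level boxes of the tower (four equation binders)
      {lo hi : ℕ → Pt (F.P K).d}
      (_ : lo 0 = fun i => ((F.P K).L : ℤ) * (sqLo (F.P K).L a ρ (K - n) 1 i - 1))
      (_ : hi 0 = fun i => ((F.P K).L : ℤ) * (sqHi (F.P K).L a M ρ (K - n) 1 i + 1) + (((F.P K).L : ℤ) - 1))
      (_ : ∀ j, 1 ≤ j → lo j = sqLo (F.P K).L a ρ (K - n) j - 1) (_ : ∀ j, 1 ≤ j → hi j = sqHi (F.P K).L a M ρ (K - n) j + 1)
      -- the (r1)+(r4) row's Landau copy, its gauge, the per-level bond letters on the canonical boxes, the uniform `σ` against the closed-form widths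
      (uL : GaugeTransf (F.P K) 0 (SU N)) (U₁ : GaugeField (F.P K) 0 (SU N)) (v av : ℕ → ℝ) {σ : ℝ}
      (_ : ∀ j, 0 ≤ v j) (_ : ∀ j, 0 ≤ av j) (_ : σ ≤ 1 / 2)
      (_ : ∀ j ≤ K - n, (((F.P K).d * ((M + 4 * ρ + 3) * (F.P K).L ^ ((K - n) - j)) : ℕ) : ℝ) * (v j + av j) ≤ σ)
      (_ : ∀ j ≤ K - n, ∀ c : PBond (F.P K) j, c.src ∈ (castSite '' Set.Icc (lo j) (hi j) : Set (Site (F.P K) j)) →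
        c.tgt ∈ (castSite '' Set.Icc (lo j) (hi j) : Set (Site (F.P K) j)) → dist1 (Averaging.iter (avOfRecord F N K) j (gaugeAct uL U₁) c) ≤ v j)
      (_ : ∀ j ≤ K - n, ∀ c : PBond (F.P K) j, c.src ∈ (castSite '' Set.Icc (lo j) (hi j) : Set (Site (F.P K) j)) →
        c.tgt ∈ (castSite '' Set.Icc (lo j) (hi j) : Set (Site (F.P K) j)) → dist1 (Averaging.iter (avOfRecord F N K) j U₁ c) ≤ av j)
      -- the shift family, dominated by the (r1) letter family, and its datum
      (lam : (j : ℕ) → Site (F.P K) j → MatA N)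
      (_ : ∀ (j : ℕ) (y : Site (F.P K) j), ‖lam j y‖ ≤ ‖mlog (((((toMS uL j (castSite (lo j)))⁻¹ * toMS uL j y)⁻¹ : SU N)) : MatA N)‖)
      {X : BondIdx (cubeDomains (F.P K) a M ρ (K - n) hk) → MatA N}
      (_ : ∀ c : BondIdx (cubeDomains (F.P K) a M ρ (K - n) hk),
        X c = LatticeFieldCalculus.grad (((F.P K).L : ℝ) ^ (K - n) / ((F.P K).L : ℝ) ^ (c.1.1 : ℕ)) (lam c.1.1) c.1.2)
      -- S3's gauge of `U` on the window, the first summand with its letters, and the (159) identity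
      {U : GaugeField (F.P K) 0 (SU N)} (u : GaugeTransf (F.P K) 0 (SU N)) {A A₁ : PBond (F.P K) 0 → MatA N} {t t₁ : ℝ}
      (_ : ∀ b ∈ (Sect2.regionOfSet (F.P K) (cover (F.P K) '' box (F.P K).L a M (K - n))).bonds,
        gaugeU (fun x => ιSU N (u x)) (fun b' => ιSU N (U b')) b = expI ((F.P K).eta (K - n)) (A b))
      (_ : ∀ b ∈ (Sect2.regionOfSet (F.P K) (cover (F.P K) '' box (F.P K).L a M (K - n))).bonds, ‖A b‖ < t)
      (_ : ∀ q ∈ (Sect2.regionOfSet (F.P K) (cover (F.P K) '' box (F.P K).L a M (K - n))).dpairs,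
        ‖grad ((F.P K).eta (K - n)) q.2.1 (fun y => A ⟨y, q.2.2⟩) q.1‖ < t)
      (_ : Letters10On (cover (F.P K) '' box (F.P K).L a M (K - n)) ((F.P K).eta (K - n)) t₁ A₁)
      (_ : ∀ b, A b - HV X b = A₁ b + HV B b - HV B' b)
      -- thresholds in the doors' currencies
      {t₂ t₃ tD : ℝ} (_ : 1 / 4 * (M : ℝ) * max (4 * CH * BH * β₁) (θ * (β₂ / M)) < t₂) (_ : 1 / 4 * max (4 * CH * BH * s) (θ * s) < t₃)
      (_ : 2 * CS * BS * (4 * σ) < tD),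
      LocalGaugeSplitOn (cover (F.P K) '' box (F.P K).L a M (K - n)) ((F.P K).eta (K - n)) t (t₁ + (t₂ + tD) + t₃) U := by
  obtain ⟨MhS, RS, CS, δS₀, δS, BS, hCS, _, _, hBS, hshear⟩ := localGaugeSplitOn_of_gauge152_recordShear_dominated_cubeDomains_box F N
  obtain ⟨MhH, RH, CH, δH₀, δH, BH, hCH, _, hδH, hBH, hH⟩ := letters10On_HB_cubeDomains_box F N
  refine ⟨max MhS MhH, max RS RH, CS, BS, CH, δH, BH, hCS, hBS, hCH, hδH, hBH, ?_⟩
  intro n K hk1 hk' hk Mh R a' hMha hMh hR hsize a M ρ hM1 hρ ha hM hper hRρ hLρ hinj HV hHV xc hxc β₁ β₂ θ hβ₁ hβ₂ h163 B hX₁ hX₂ B' s hs hB'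
    lo hi hlo0 hhi0 hloj hhij uL U₁ v av σ hv0 ha0 hσ hDσ hv hav lam hlam X hX U u A A₁ t t₁ he hA hdA h₁ h159 t₂ t₃ tD ht₂ ht₃ htD
  have hMhS : MhS ≤ Mh := (le_max_left _ _).trans hMh
  have hMhH : MhH ≤ Mh := (le_max_right _ _).trans hMh
  have hRS : RS ≤ R := (le_max_left _ _).trans hR
  have hRH : RH ≤ R := (le_max_right _ _).trans hR
  have hMr : (1 : ℝ) ≤ M := by exact_mod_cast hM1
  have hM0 : (0 : ℝ) < M := by linarith
  have hL1 : (1 : ℝ) ≤ ((F.P K).L : ℝ) := by exact_mod_cast (F.P K).L_pos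
  -- the `HB` letter (A₂ := H_V B): data (160) centred ⇒ near shape via `near_of_centred_box` (`M_Δ := M`), (155) uniform ⇒ far shape via `L^{k−j} ≥ 1`
  have hnear := near_of_centred_box (cubeDomains (F.P K) a M ρ (K - n) hk) (a := a) (M := M) hk hM1 hxc hβ₁ hX₁
  have h₂ : Letters10On (cover (F.P K) '' box (F.P K).L a M (K - n)) ((F.P K).eta (K - n)) t₂ (HV B) := by
    refine hH n K hk1 hk' hk hMha hMhH hRH hsize hρ ha hM hper hRρ hinj (Cd := 1) (MΔ := (M : ℝ)) (ε₁ := β₁) (θ := θ)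
      (ε := fun _ => β₂ / M) zero_le_one hM0.le hβ₁ (div_nonneg hβ₂ hM0.le) (fun _ _ => by linarith [div_nonneg hβ₂ hM0.le])
      (by simpa using h163) hHV (fun b hb c hc => ?_) (fun c hc => ?_) (by simpa using ht₂)
    · have h := hnear b hb c hc
      calc ‖B c‖ ≤ β₁ * M * (distBI (cubeDomains (F.P K) a M ρ (K - n) hk) b c + 1) := h
        _ = 1 * (M : ℝ) * β₁ * (distBI (cubeDomains (F.P K) a M ρ (K - n) hk) b c + 1) := by ring
    · have hpow : (1 : ℝ) ≤ ((F.P K).L : ℝ) ^ ((K - n) - (c.1.1 : ℕ)) := one_le_pow₀ hL1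
      have hMβ : 1 * (M : ℝ) * (β₂ / M) = β₂ := by field_simp
      calc ‖B c‖ ≤ β₂ := hX₂ c hc
        _ ≤ β₂ * ((F.P K).L : ℝ) ^ ((K - n) - (c.1.1 : ℕ)) := by nlinarith
        _ = 1 * (M : ℝ) * (β₂ / M) * ((F.P K).L : ℝ) ^ ((K - n) - (c.1.1 : ℕ)) := by rw [hMβ]
  -- the uniform letter (A₃ := H_V B′), same `H`-constants, `C_d = M_Δ = 1`
  have h₃ : Letters10On (cover (F.P K) '' box (F.P K).L a M (K - n)) ((F.P K).eta (K - n)) t₃ (HV B') := by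
    refine hH n K hk1 hk' hk hMha hMhH hRH hsize hρ ha hM hper hRρ hinj (Cd := 1) (MΔ := 1) (ε₁ := s) (θ := θ) (ε := fun _ => s)
      zero_le_one zero_le_one hs hs (fun _ _ => by linarith) (by simpa using h163) hHV (fun b _ c _ => ?_) (fun c _ => ?_) (by simpa using ht₃)
    · have hd := Summit.QuantumFields.YangMills.Theorems.HalvingQuarterCubeSeq.distBI_nonneg (cubeDomains (F.P K) a M ρ (K - n) hk) b c
      calc ‖B' c‖ ≤ s := hB' c
        _ ≤ 1 * 1 * s * (distBI (cubeDomains (F.P K) a M ρ (K - n) hk) b c + 1) := by nlinarith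
    · have hpow : (1 : ℝ) ≤ ((F.P K).L : ℝ) ^ ((K - n) - (c.1.1 : ℕ)) := one_le_pow₀ hL1
      calc ‖B' c‖ ≤ s := hB' c
        _ ≤ 1 * 1 * s * ((F.P K).L : ℝ) ^ ((K - n) - (c.1.1 : ℕ)) := by nlinarith
  -- the shift side: FILE 2 with `A₂ := H_V B`, `A₃ := H_V B′`
  exact hshear n K hk1 hk' hk hMha hMhS hRS hsize hρ ha hM hper hRρ hLρ hinj hHV hlo0 hhi0 hloj hhij uL U₁ v av hv0 ha0 hσ hDσ hv hav lam hlam hX u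
    he hA hdA h159 h₁ h₂ h₃ htD

open scoped Classical in
/-- ★★★ **THE SAME AT THE PRINT DATUM OF A GRID CUBE** — the per-datum keying of the S6 head's tokens (`DatumGaugeSplitTopStepCore(G∕R)`: window
`π '' box L (cornerP Mc ρ a) (sideP Mc ρ) j`): `localGaugeSplitOn_head159_cubeDomains_box` at `a := cornerP Mc ρ idx`, `M := sideP Mc ρ`, with the five numerics ∕ non-wrapping
binders (`L·M_h ∣ ρ, a_i, M, sitesPerDir`, `Set.InjOn π □₀`) and `1 ≤ M` DISCHARGED by k0-s1-w3's `numerics_propCubeP` ∕ n07-e 36a `le_sideP` from THREE arithmetic facts: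
`F.L·M_h ∣ ρ`, `a′ + 3 ≤ F.m + n` (already a binder), and the torus-size floor `Mc + 11d + 6ρ ≤ sitesPerDir (K − n)`.
[cite: Balaban1985Variational, (144) p.300, (157)–(159) pp.302–303, (163)–(165) p.304; Balaban1985RegularSpaces, p.98, (1.131) p.99; Balaban1984PropagatorsII, (2.1)–(2.4) p.224, Cor. 2.8 (2.150)–(2.151) p.249] -/
theorem localGaugeSplitOn_head159_printCube_box (F : T4Family) (N : ℕ) [NeZero N] :
    ∃ (Mh₀ R₀ : ℕ) (CS BS CH δH BH : ℝ), 0 ≤ CS ∧ 0 < BS ∧ 0 ≤ CH ∧ 0 < δH ∧ 0 < BH ∧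
    ∀ (n K : ℕ) (_ : 1 ≤ K - n) (_ : K - n + 1 ≤ F.m + K) (hk : K - n ≤ (F.P K).m + (F.P K).K)
      {Mh R a' : ℕ} (_ : Mh = F.L ^ a') (_ : Mh₀ ≤ Mh) (_ : R₀ ≤ R) (_ : a' + 3 ≤ F.m + n)
      -- the PRINT DATUM of the grid cube `(Mc, idx)` at collar `ρ`: corner `cornerP`, side `sideP`; arithmetic side conditions only
      {idx : Pt (F.P K).d} {Mc ρ : ℕ} (hLρ : (F.P K).L ≤ ρ) (_ : F.L * Mh ∣ ρ) (_ : R * (F.L * Mh) ≤ ρ)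
      (_ : Mc + 11 * (F.P K).d + 6 * ρ ≤ (F.P K).sitesPerDir (K - n))
      {HV : (BondIdx (cubeDomains (F.P K) (cornerP (F.P K) Mc ρ idx) (sideP (F.P K) Mc ρ) ρ (K - n) hk) → MatA N) →ₗ[ℂ] (PBond (F.P K) 0 → MatA N)}
      (_ : ∀ (B : BondIdx (cubeDomains (F.P K) (cornerP (F.P K) Mc ρ idx) (sideP (F.P K) Mc ρ) ρ (K - n) hk) → MatA N) (b : PBond (F.P K) 0),
        HV B b = ∑ c, ((flatH (F.P K) (K - n) (cubeDomains (F.P K) (cornerP (F.P K) Mc ρ idx) (sideP (F.P K) Mc ρ) ρ (K - n) hk) (Pi.single c 1) b : ℝ) : ℂ) • B c)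
      -- the `HB` summand's datum in print's shapes: (160) centred at a window point, (155) uniform below; the (163)-type smallness of `θ`
      {xc : Pt (F.P K).d} (_ : xc ∈ box (F.P K).L (cornerP (F.P K) Mc ρ idx) (sideP (F.P K) Mc ρ) (K - n))
      {β₁ β₂ θ : ℝ} (_ : 0 ≤ β₁) (_ : 0 ≤ β₂) (_ : 8 * CH * BH * Real.exp (-(δH * (ρ : ℝ))) ≤ θ)
      {B : BondIdx (cubeDomains (F.P K) (cornerP (F.P K) Mc ρ idx) (sideP (F.P K) Mc ρ) ρ (K - n) hk) → MatA N}
      (_ : ∀ c : BondIdx (cubeDomains (F.P K) (cornerP (F.P K) Mc ρ idx) (sideP (F.P K) Mc ρ) ρ (K - n) hk), (c.1.1 : ℕ) = K - n →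
        ‖B c‖ ≤ β₁ * (distSite (Mk (F.P K) (c.1.1 : ℕ)) c.1.2.src (iterBlockOf (c.1.1 : ℕ) (cover (F.P K) xc)) + 1))
      (_ : ∀ c : BondIdx (cubeDomains (F.P K) (cornerP (F.P K) Mc ρ idx) (sideP (F.P K) Mc ρ) ρ (K - n) hk), (c.1.1 : ℕ) < K - n → ‖B c‖ ≤ β₂)
      -- the third summand's datum, uniformly small
      {B' : BondIdx (cubeDomains (F.P K) (cornerP (F.P K) Mc ρ idx) (sideP (F.P K) Mc ρ) ρ (K - n) hk) → MatA N} {s : ℝ} (_ : 0 ≤ s) (_ : ∀ c, ‖B' c‖ ≤ s)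
      -- the CANONICAL level boxes of the tower (four equation binders)
      {lo hi : ℕ → Pt (F.P K).d}
      (_ : lo 0 = fun i => ((F.P K).L : ℤ) * (sqLo (F.P K).L (cornerP (F.P K) Mc ρ idx) ρ (K - n) 1 i - 1))
      (_ : hi 0 = fun i => ((F.P K).L : ℤ) * (sqHi (F.P K).L (cornerP (F.P K) Mc ρ idx) (sideP (F.P K) Mc ρ) ρ (K - n) 1 i + 1) + (((F.P K).L : ℤ) - 1))
      (_ : ∀ j, 1 ≤ j → lo j = sqLo (F.P K).L (cornerP (F.P K) Mc ρ idx) ρ (K - n) j - 1) (_ : ∀ j, 1 ≤ j → hi j = sqHi (F.P K).L (cornerP (F.P K) Mc ρ idx) (sideP (F.P K) Mc ρ) ρ (K - n) j + 1)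
      -- the (r1)+(r4) row's Landau copy, its gauge, the per-level bond letters on the canonical boxes, the uniform `σ` against the closed-form widths
      (uL : GaugeTransf (F.P K) 0 (SU N)) (U₁ : GaugeField (F.P K) 0 (SU N)) (v av : ℕ → ℝ) {σ : ℝ}
      (_ : ∀ j, 0 ≤ v j) (_ : ∀ j, 0 ≤ av j) (_ : σ ≤ 1 / 2)
      (_ : ∀ j ≤ K - n, (((F.P K).d * ((sideP (F.P K) Mc ρ + 4 * ρ + 3) * (F.P K).L ^ ((K - n) - j)) : ℕ) : ℝ) * (v j + av j) ≤ σ)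
      (_ : ∀ j ≤ K - n, ∀ c : PBond (F.P K) j, c.src ∈ (castSite '' Set.Icc (lo j) (hi j) : Set (Site (F.P K) j)) →
        c.tgt ∈ (castSite '' Set.Icc (lo j) (hi j) : Set (Site (F.P K) j)) → dist1 (Averaging.iter (avOfRecord F N K) j (gaugeAct uL U₁) c) ≤ v j)
      (_ : ∀ j ≤ K - n, ∀ c : PBond (F.P K) j, c.src ∈ (castSite '' Set.Icc (lo j) (hi j) : Set (Site (F.P K) j)) →
        c.tgt ∈ (castSite '' Set.Icc (lo j) (hi j) : Set (Site (F.P K) j)) → dist1 (Averaging.iter (avOfRecord F N K) j U₁ c) ≤ av j)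
      -- the shift family, dominated by the (r1) letter family, and its datum
      (lam : (j : ℕ) → Site (F.P K) j → MatA N)
      (_ : ∀ (j : ℕ) (y : Site (F.P K) j), ‖lam j y‖ ≤ ‖mlog (((((toMS uL j (castSite (lo j)))⁻¹ * toMS uL j y)⁻¹ : SU N)) : MatA N)‖)
      {X : BondIdx (cubeDomains (F.P K) (cornerP (F.P K) Mc ρ idx) (sideP (F.P K) Mc ρ) ρ (K - n) hk) → MatA N}
      (_ : ∀ c : BondIdx (cubeDomains (F.P K) (cornerP (F.P K) Mc ρ idx) (sideP (F.P K) Mc ρ) ρ (K - n) hk),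
        X c = LatticeFieldCalculus.grad (((F.P K).L : ℝ) ^ (K - n) / ((F.P K).L : ℝ) ^ (c.1.1 : ℕ)) (lam c.1.1) c.1.2)
      -- S3's gauge of `U` on the window, the first summand with its letters, and the (159) identity
      {U : GaugeField (F.P K) 0 (SU N)} (u : GaugeTransf (F.P K) 0 (SU N)) {A A₁ : PBond (F.P K) 0 → MatA N} {t t₁ : ℝ}
      (_ : ∀ b ∈ (Sect2.regionOfSet (F.P K) (cover (F.P K) '' box (F.P K).L (cornerP (F.P K) Mc ρ idx) (sideP (F.P K) Mc ρ) (K - n))).bonds,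
        gaugeU (fun x => ιSU N (u x)) (fun b' => ιSU N (U b')) b = expI ((F.P K).eta (K - n)) (A b))
      (_ : ∀ b ∈ (Sect2.regionOfSet (F.P K) (cover (F.P K) '' box (F.P K).L (cornerP (F.P K) Mc ρ idx) (sideP (F.P K) Mc ρ) (K - n))).bonds, ‖A b‖ < t)
      (_ : ∀ q ∈ (Sect2.regionOfSet (F.P K) (cover (F.P K) '' box (F.P K).L (cornerP (F.P K) Mc ρ idx) (sideP (F.P K) Mc ρ) (K - n))).dpairs,
        ‖grad ((F.P K).eta (K - n)) q.2.1 (fun y => A ⟨y, q.2.2⟩) q.1‖ < t)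
      (_ : Letters10On (cover (F.P K) '' box (F.P K).L (cornerP (F.P K) Mc ρ idx) (sideP (F.P K) Mc ρ) (K - n)) ((F.P K).eta (K - n)) t₁ A₁)
      (_ : ∀ b, A b - HV X b = A₁ b + HV B b - HV B' b)
      -- thresholds in the doors' currencies
      {t₂ t₃ tD : ℝ} (_ : 1 / 4 * ((sideP (F.P K) Mc ρ : ℕ) : ℝ) * max (4 * CH * BH * β₁) (θ * (β₂ / ((sideP (F.P K) Mc ρ : ℕ) : ℝ))) < t₂) (_ : 1 / 4 * max (4 * CH * BH * s) (θ * s) < t₃)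
      (_ : 2 * CS * BS * (4 * σ) < tD),
      LocalGaugeSplitOn (cover (F.P K) '' box (F.P K).L (cornerP (F.P K) Mc ρ idx) (sideP (F.P K) Mc ρ) (K - n)) ((F.P K).eta (K - n)) t (t₁ + (t₂ + tD) + t₃) U := by
  obtain ⟨Mh₀, R₀, CS, BS, CH, δH, BH, hCS, hBS, hCH, hδH, hBH, hmain⟩ := localGaugeSplitOn_head159_cubeDomains_box F N
  refine ⟨Mh₀, R₀, CS, BS, CH, δH, BH, hCS, hBS, hCH, hδH, hBH, ?_⟩
  intro n K hk1 hk' hk Mh R a' hMha hMh hR hsize idx Mc ρ hLρ hdvd hRρ hw HV hHV xc hxc β₁ β₂ θ hβ₁ hβ₂ h163 B hX₁ hX₂ B' s hs hB'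
    lo hi hlo0 hhi0 hloj hhij uL U₁ v av σ hv0 ha0 hσ hDσ hv hav lam hlam X hX U u A A₁ t t₁ he hA hdA h₁ h159 t₂ t₃ tD ht₂ ht₃ htD
  -- the five numerics ∕ non-wrapping binders at the print datum (k0-s1-w3), `1 ≤ M′` and `F.L ≤ ρ`
  obtain ⟨ha, hM, -, hper, hinj⟩ := numerics_propCubeP F hk1 hk hMha (by omega) hLρ hdvd idx hw
  have hρpos : 0 < ρ := lt_of_lt_of_le (F.P K).L_pos hLρ
  have hM1 : 1 ≤ sideP (F.P K) Mc ρ := by have := le_sideP (P := F.P K) Mc hρpos; omega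
  have hLρ' : F.L ≤ ρ := hLρ
  exact hmain n K hk1 hk' hk hMha hMh hR hsize hM1 hdvd ha hM hper hRρ hLρ' hinj hHV hxc hβ₁ hβ₂ h163 hX₁ hX₂ hs hB' hlo0 hhi0 hloj hhij
    uL U₁ v av hv0 ha0 hσ hDσ hv hav lam hlam hX u he hA hdA h₁ h159 ht₂ ht₃ htD

end Summit.QuantumFields.YangMills.BalabanUVNodes.N07SplitClauseHeadAtCubeDomains

end
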